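import Summits.Parity.BatemanHorn.Theorems.IsogenyRedeiPencilSelmerDictionaryKernelCountAux

/-!
# Route IsogenyRedei, crux `PencilSelmerDictionary` (stmt-Parity-11584), line `toric-node-vacuity-cassels`:
# stub E `stub_twoAdicKernelCount` — counting the 2-adic kernel of the `b`-side descent

For `t ≥ 1` let `n = t² + 1`. The explicit `b`-side Selmer set of the pencil `E_t = ⟨0, 2t, 0, t²+1, 0⟩`
is the set of positive squarefree `d ∣ n` passing the 2-adic table of stub C (`stub_bSideTwoAdic`):
odd `d`: `d ≡ 1 (8)` always, `d ≡ 5 (8)` iff `t ≡ 1, 2 (4)`; even `d = 2m`: `m ≡ 1 (8)` iff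
`t ≡ 1 (4) ∨ t ≡ 7 (8)`, `m ≡ 5 (8)` iff `t ≡ 1 (4) ∨ t ≡ 3 (8)`. This file proves that this set has
exactly `2^{ω(n) − r(t)}` elements, `r = 1` iff `t ≡ 3 (8)` or (`t ≡ 0 (4) ∨ t ≡ 7 (8)`) and some prime
factor of `n` is `≡ 5 (8)`, else `r = 0` — the registered signature of the stub, verbatim.

Proof: positive squarefree divisors of `n` ↔ subsets `S` of `n.primeFactors` (auxiliary file); every
odd prime factor of `n` is `≡ 1 (mod 4)`, so the class of `d = ∏ S` in `{1, 5, 2, 10}` is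
(`2 ∈ S`, parity of `#{p ∈ S : p ≡ 5 (8)}`) (`prod_residues`); per residue of `t mod 8` the table keeps
all subsets, the subsets with an even number of marked primes, or one parity on each of the halves
`2 ∉ S` / `2 ∈ S`, whence `2^ω` or `2^{ω−1}` by parity halving (auxiliary file).

No definitions, no named facts; Mathlib only. Numerics (planner, from the definitions): kit j011624,
300/300 `t ≤ 300`, 0 failures. [folklore]
-/

/-! ## The count (stub E of line `toric-node-vacuity-cassels`) -/

namespace Summit.Parity.BatemanHorn.Theorems.PencilSelmerDictionary

open Finset
open scoped Classical

/-- An odd natural number dividing `t² + 1` is `≡ 1 (mod 4)` (sum of two squares). [folklore] -/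
private theorem mod_four_eq_one_of_dvd_sq_add_one' {d t : ℕ} (hodd : d % 2 = 1)
    (hdvd : d ∣ t ^ 2 + 1) : d % 4 = 1 := by
  have hsq : IsSquare (-1 : ZMod d) := by
    refine ⟨(t : ZMod d), ?_⟩
    have h0 : ((t ^ 2 + 1 : ℕ) : ZMod d) = 0 := (ZMod.natCast_eq_zero_iff _ _).mpr hdvd
    push_cast at h0
    linear_combination -h0
  obtain ⟨x, y, hxy⟩ := Nat.eq_sq_add_sq_of_isSquare_mod_neg_one hsq
  rcases Nat.even_or_odd' x with ⟨a, rfl | rfl⟩ <;> rcases Nat.even_or_odd' y with ⟨b, rfl | rfl⟩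
  · exfalso
    have : d = 4 * (a ^ 2 + b ^ 2) := by rw [hxy]; ring
    omega
  · have : d = 4 * (a ^ 2 + b ^ 2 + b) + 1 := by rw [hxy]; ring
    omega
  · have : d = 4 * (a ^ 2 + a + b ^ 2) + 1 := by rw [hxy]; ring
    omega
  · exfalso
    have : d = 4 * (a ^ 2 + a + b ^ 2 + b) + 2 := by rw [hxy]; ring
    omega

/-- The odd prime factors of `t² + 1` are `≡ 1` or `≡ 5 (mod 8)`. [folklore] -/
theorem mod_eight_of_mem_primeFactors_sq_add_one {t p : ℕ} (hp : p ∈ (t ^ 2 + 1).primeFactors)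
    (hp2 : p ≠ 2) : p % 8 = 1 ∨ p % 8 = 5 := by
  have hpp := Nat.prime_of_mem_primeFactors hp
  have h4 := mod_four_eq_one_of_dvd_sq_add_one' (hpp.eq_two_or_odd.resolve_left hp2)
    (Nat.dvd_of_mem_primeFactors hp)
  omega

/-- `2 ∣ t² + 1` iff `t` is odd. [folklore] -/
theorem two_mem_primeFactors_sq_add_one_iff (t : ℕ) : 2 ∈ (t ^ 2 + 1).primeFactors ↔ t % 2 = 1 := by
  rw [Nat.mem_primeFactors]
  constructor
  · rintro ⟨-, h2, -⟩
    by_contra hodd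
    obtain ⟨k, rfl⟩ : ∃ k, t = 2 * k := ⟨t / 2, by omega⟩
    have : 2 ∣ (2 * k) ^ 2 := ⟨2 * k ^ 2, by ring⟩
    have h1 : 2 ∣ 1 := (Nat.dvd_add_right this).mp h2
    omega
  · intro hodd
    refine ⟨Nat.prime_two, ?_, by positivity⟩
    obtain ⟨k, rfl⟩ : ∃ k, t = 2 * k + 1 := ⟨t / 2, by omega⟩
    exact ⟨2 * k ^ 2 + 2 * k + 1, by ring⟩

/-- **The residue data of a squarefree divisor of `t² + 1` in terms of its set of prime factors.**
For `S ⊆ (t²+1).primeFactors` with product `x`: if `2 ∉ S` then `x` is odd and `x ≡ 1` or `5 (mod 8)`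
according to the parity of `#{p ∈ S : p ≡ 5 (8)}`; if `2 ∈ S` then `x` is even and `x / 2` has that
residue. [folklore] -/
theorem prod_residues {t : ℕ} {S : Finset ℕ} (hS : S ⊆ (t ^ 2 + 1).primeFactors) :
    (2 ∉ S → (∏ p ∈ S, p) % 2 = 1 ∧
      (∏ p ∈ S, p) % 8 = if Even (S.filter (fun p => p % 8 = 5)).card then 1 else 5) ∧
    (2 ∈ S → (∏ p ∈ S, p) % 2 = 0 ∧
      (∏ p ∈ S, p) / 2 % 8 = if Even (S.filter (fun p => p % 8 = 5)).card then 1 else 5) := by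
  constructor
  · intro h2
    have hres := prod_mod_eight_eq S fun p hp =>
      mod_eight_of_mem_primeFactors_sq_add_one (hS hp) (fun h => h2 (h ▸ hp))
    refine ⟨?_, hres⟩
    split_ifs at hres <;> omega
  · intro h2
    have hsplit : (∏ p ∈ S, p) = 2 * ∏ p ∈ S.erase 2, p := (mul_prod_erase S (fun p => p) h2).symm
    have hres := prod_mod_eight_eq (S.erase 2) fun p hp =>
      mod_eight_of_mem_primeFactors_sq_add_one (hS (mem_of_mem_erase hp)) (ne_of_mem_erase hp)
    have hfil : (S.erase 2).filter (fun p => p % 8 = 5) = S.filter (fun p => p % 8 = 5) := by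
      rw [filter_erase, erase_eq_of_notMem]
      simp
    rw [hfil] at hres
    rw [hsplit, Nat.mul_mod_right, Nat.mul_div_cancel_left _ two_pos]
    exact ⟨rfl, hres⟩

/-- **Stub E — counting the 2-adic kernel.** For `t ≥ 1` the number of positive squarefree
`d ∣ t² + 1` passing the 2-adic table of the `b`-side descent (stub C of the line) is
`2^{ω(t²+1) − r(t)}` with `r = 1` iff `t ≡ 3 (mod 8)`, or (`t ≡ 0 (mod 4)` or `t ≡ 7 (mod 8)`) and some
prime factor of `t² + 1` is `≡ 5 (mod 8)`; else `r = 0`. Proof: positive squarefree divisors of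
`t² + 1` ↔ subsets `S` of its prime factors; every odd prime factor is `≡ 1 (mod 4)`, so the class of
`d = ∏ S` in `{1, 5, 2, 10}` is (`2 ∈ S`, parity of `#{p ∈ S : p ≡ 5 (8)}`); per residue of `t` the
table keeps all subsets, the even ones, or one parity on each half `2 ∈ S` / `2 ∉ S`, whence `2^ω`
or `2^{ω−1}` by parity halving. [folklore] -/
theorem stub_twoAdicKernelCount :
    ∀ t : ℕ, 1 ≤ t →
      ((Finset.Icc (1 : ℤ) ((t : ℤ) ^ 2 + 1)).filter (fun d : ℤ =>
          Squarefree d ∧ d ∣ (t : ℤ) ^ 2 + 1 ∧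
            ((d % 2 = 1 ∧ (d % 8 = 1 ∨ (d % 8 = 5 ∧ (t % 4 = 1 ∨ t % 4 = 2)))) ∨
              (d % 2 = 0 ∧ ((d / 2 % 8 = 1 ∧ (t % 4 = 1 ∨ t % 8 = 7)) ∨
                (d / 2 % 8 = 5 ∧ (t % 4 = 1 ∨ t % 8 = 3))))))).card =
        2 ^ ((t ^ 2 + 1).primeFactors.card -
          (if t % 8 = 3 ∨ ((t % 4 = 0 ∨ t % 8 = 7) ∧ ∃ p ∈ (t ^ 2 + 1).primeFactors, p % 8 = 5)
            then 1 else 0)) := by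
  intro t ht
  set n : ℕ := t ^ 2 + 1 with hn
  have hn0 : n ≠ 0 := by positivity
  set P : Finset ℕ := n.primeFactors with hP
  -- the table as a predicate on naturals
  set TABN : ℕ → Prop := fun m =>
    (m % 2 = 1 ∧ (m % 8 = 1 ∨ (m % 8 = 5 ∧ (t % 4 = 1 ∨ t % 4 = 2)))) ∨
      (m % 2 = 0 ∧ ((m / 2 % 8 = 1 ∧ (t % 4 = 1 ∨ t % 8 = 7)) ∨
        (m / 2 % 8 = 5 ∧ (t % 4 = 1 ∨ t % 8 = 3)))) with hTABN
  ------------------------------------------------------------------------------------------------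
  -- Step 1: transfer to the squarefree divisors of `n` in `ℕ`
  ------------------------------------------------------------------------------------------------
  have hcast : (t : ℤ) ^ 2 + 1 = (n : ℤ) := by rw [hn]; push_cast; ring
  have step1 : ((Finset.Icc (1 : ℤ) ((t : ℤ) ^ 2 + 1)).filter (fun d : ℤ =>
          Squarefree d ∧ d ∣ (t : ℤ) ^ 2 + 1 ∧
            ((d % 2 = 1 ∧ (d % 8 = 1 ∨ (d % 8 = 5 ∧ (t % 4 = 1 ∨ t % 4 = 2)))) ∨
              (d % 2 = 0 ∧ ((d / 2 % 8 = 1 ∧ (t % 4 = 1 ∨ t % 8 = 7)) ∨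
                (d / 2 % 8 = 5 ∧ (t % 4 = 1 ∨ t % 8 = 3))))))) =
      ((n.divisors.filter Squarefree).filter TABN).image (Nat.cast : ℕ → ℤ) := by
    ext d
    simp only [mem_filter, mem_Icc, mem_image, Nat.mem_divisors, hcast]
    constructor
    · rintro ⟨⟨h1, -⟩, hsq, hdvd, htab⟩
      lift d to ℕ using (by omega : (0 : ℤ) ≤ d) with m
      refine ⟨m, ⟨⟨⟨Int.natCast_dvd_natCast.mp hdvd, hn0⟩, Int.squarefree_natCast.mp hsq⟩, ?_⟩, rfl⟩
      simp only [hTABN]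
      omega
    · rintro ⟨m, ⟨⟨⟨hdvd, -⟩, hsq⟩, htab⟩, rfl⟩
      have hm0 : m ≠ 0 := hsq.ne_zero
      have hle : m ≤ n := Nat.le_of_dvd (Nat.pos_of_ne_zero hn0) hdvd
      refine ⟨⟨by exact_mod_cast Nat.pos_of_ne_zero hm0, by exact_mod_cast hle⟩,
        Int.squarefree_natCast.mpr hsq, Int.natCast_dvd_natCast.mpr hdvd, ?_⟩
      simp only [hTABN] at htab
      omega
  rw [step1, card_image_of_injective _ Nat.cast_injective]
  ------------------------------------------------------------------------------------------------
  -- Step 2: squarefree divisors = products of subsets of `P`, injectively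
  ------------------------------------------------------------------------------------------------
  rw [squarefreeDivisors_eq_image hn0, filter_image,
    card_image_of_injOn ((prod_injOn_powerset_primeFactors n).mono
      (coe_subset.mpr (filter_subset _ _)))]
  ------------------------------------------------------------------------------------------------
  -- Step 3: the table on `∏ S` is a condition on (`2 ∈ S`, parity of the marked primes)
  ------------------------------------------------------------------------------------------------
  set EV : Finset ℕ → Prop := fun S => Even (S.filter (fun p => p % 8 = 5)).card with hEV
  have step3 : (P.powerset.filter fun S => TABN (∏ p ∈ S, p)) =
      P.powerset.filter fun S =>
        (2 ∉ S ∧ (EV S ∨ (¬ EV S ∧ (t % 4 = 1 ∨ t % 4 = 2)))) ∨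
          (2 ∈ S ∧ ((EV S ∧ (t % 4 = 1 ∨ t % 8 = 7)) ∨ (¬ EV S ∧ (t % 4 = 1 ∨ t % 8 = 3)))) := by
    refine filter_congr fun S hS => ?_
    have hSP : S ⊆ (t ^ 2 + 1).primeFactors := mem_powerset.mp hS
    obtain ⟨hodd, heven⟩ := prod_residues hSP
    simp only [hTABN, hEV]
    by_cases h2 : 2 ∈ S
    · obtain ⟨hm2, hm8⟩ := heven h2
      by_cases hE : Even (S.filter (fun p => p % 8 = 5)).card
      · rw [if_pos hE] at hm8
        simp [h2, hE, hm2, hm8]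
      · rw [if_neg hE] at hm8
        simp [h2, hE, hm2, hm8]
    · obtain ⟨hm2, hm8⟩ := hodd h2
      by_cases hE : Even (S.filter (fun p => p % 8 = 5)).card
      · rw [if_pos hE] at hm8
        simp [h2, hE, hm2, hm8]
      · rw [if_neg hE] at hm8
        simp [h2, hE, hm2, hm8]
  rw [step3]
  ------------------------------------------------------------------------------------------------
  -- Step 4: count, residue class by residue class
  ------------------------------------------------------------------------------------------------
  have h2P : 2 ∈ P ↔ t % 2 = 1 := two_mem_primeFactors_sq_add_one_iff t
  have hβ2 : (∃ p ∈ P, p % 8 = 5) ↔ ∃ p ∈ P.erase 2, p % 8 = 5 := by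
    constructor
    · rintro ⟨p, hp, h5⟩
      exact ⟨p, mem_erase.mpr ⟨by omega, hp⟩, h5⟩
    · rintro ⟨p, hp, h5⟩
      exact ⟨p, mem_of_mem_erase hp, h5⟩
  have hmod8 : t % 8 < 8 := Nat.mod_lt _ (by norm_num)
  -- the count of even subsets of a set `Q` of primes
  have heven_count : ∀ Q : Finset ℕ,
      (Q.powerset.filter fun S => EV S).card =
        2 ^ (Q.card - if ∃ p ∈ Q, p % 8 = 5 then 1 else 0) := by
    intro Q
    simp only [hEV]
    split_ifs with hβ
    · exact card_powerset_filter_even_eq (fun p => p % 8 = 5) Q hβ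
    · push Not at hβ
      rw [powerset_filter_even_eq_of_forall_not (fun p => p % 8 = 5) Q hβ, card_powerset,
        Nat.sub_zero]
  rcases Nat.even_or_odd' t with ⟨k, hk | hk⟩
  · ---------------------------------------------------------------------------------------------
    -- `t` even: `2 ∉ P`, so `2 ∉ S` for every `S ⊆ P`
    ---------------------------------------------------------------------------------------------
    have h2P' : 2 ∉ P := fun h => by have := h2P.mp h; omega
    by_cases h40 : t % 4 = 0
    · -- `t ≡ 0 (mod 4)`: the table keeps exactly the even subsets
      have hfil : (P.powerset.filter fun S =>
          (2 ∉ S ∧ (EV S ∨ (¬ EV S ∧ (t % 4 = 1 ∨ t % 4 = 2)))) ∨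
            (2 ∈ S ∧ ((EV S ∧ (t % 4 = 1 ∨ t % 8 = 7)) ∨ (¬ EV S ∧ (t % 4 = 1 ∨ t % 8 = 3))))) =
          P.powerset.filter fun S => EV S := by
        refine filter_congr fun S hS => ?_
        have h2S : 2 ∉ S := fun h => h2P' (mem_powerset.mp hS h)
        have h41 : ¬ (t % 4 = 1 ∨ t % 4 = 2) := by omega
        simp only [h2S, h41, and_false, or_false, not_false_eq_true, false_and, true_and]
      rw [hfil, heven_count P]
      congr 2
      by_cases hβ : ∃ p ∈ P, p % 8 = 5
      · rw [if_pos hβ, if_pos (Or.inr ⟨Or.inl h40, hβ⟩)]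
      · rw [if_neg hβ, if_neg (by rintro (h | ⟨-, h⟩) <;> [omega; exact hβ h])]
    · -- `t ≡ 2 (mod 4)`: the table keeps everything
      have h42 : t % 4 = 2 := by omega
      have hfil : (P.powerset.filter fun S =>
          (2 ∉ S ∧ (EV S ∨ (¬ EV S ∧ (t % 4 = 1 ∨ t % 4 = 2)))) ∨
            (2 ∈ S ∧ ((EV S ∧ (t % 4 = 1 ∨ t % 8 = 7)) ∨ (¬ EV S ∧ (t % 4 = 1 ∨ t % 8 = 3))))) =
          P.powerset := by
        refine filter_true_of_mem fun S hS => ?_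
        have h2S : 2 ∉ S := fun h => h2P' (mem_powerset.mp hS h)
        have h41 : (t % 4 = 1 ∨ t % 4 = 2) := Or.inr h42
        by_cases hE : EV S
        · exact Or.inl ⟨h2S, Or.inl hE⟩
        · exact Or.inl ⟨h2S, Or.inr ⟨hE, h41⟩⟩
      rw [hfil, card_powerset, if_neg (by rintro (h | ⟨h, -⟩) <;> omega), Nat.sub_zero]
  · ---------------------------------------------------------------------------------------------
    -- `t` odd: `2 ∈ P`, split `S ⊆ P` according to `2 ∈ S`
    ---------------------------------------------------------------------------------------------
    have h2Pm : 2 ∈ P := h2P.mpr (by omega)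
    set P₂ := P.erase 2 with hP₂
    have hPins : insert 2 P₂ = P := insert_erase h2Pm
    have h2P₂ : 2 ∉ P₂ := notMem_erase 2 P
    have hcardP : P.card = P₂.card + 1 := by
      rw [← hPins, card_insert_of_notMem h2P₂]
    have hEVins : ∀ S, EV (insert 2 S) ↔ EV S := fun S => by
      simp only [hEV]
      rw [card_filter_insert_of_not (fun p => p % 8 = 5) (by norm_num : ¬ (2 % 8 = 5))]
    have hsplit := card_powerset_insert_filter h2P₂ (fun S : Finset ℕ =>
      (2 ∉ S ∧ (EV S ∨ (¬ EV S ∧ (t % 4 = 1 ∨ t % 4 = 2)))) ∨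
        (2 ∈ S ∧ ((EV S ∧ (t % 4 = 1 ∨ t % 8 = 7)) ∨ (¬ EV S ∧ (t % 4 = 1 ∨ t % 8 = 3)))))
    rw [hPins] at hsplit
    rw [hsplit]
    -- on `P₂.powerset`: `2 ∉ S`
    have hfirst : (P₂.powerset.filter fun S =>
        (2 ∉ S ∧ (EV S ∨ (¬ EV S ∧ (t % 4 = 1 ∨ t % 4 = 2)))) ∨
          (2 ∈ S ∧ ((EV S ∧ (t % 4 = 1 ∨ t % 8 = 7)) ∨ (¬ EV S ∧ (t % 4 = 1 ∨ t % 8 = 3))))) =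
        P₂.powerset.filter fun S => EV S ∨ (¬ EV S ∧ (t % 4 = 1 ∨ t % 4 = 2)) := by
      refine filter_congr fun S hS => ?_
      have h2S : 2 ∉ S := fun h => h2P₂ (mem_powerset.mp hS h)
      simp only [h2S, not_false_eq_true, true_and, false_and, or_false]
    have hsecond : (P₂.powerset.filter fun S =>
        (2 ∉ insert 2 S ∧ (EV (insert 2 S) ∨ (¬ EV (insert 2 S) ∧ (t % 4 = 1 ∨ t % 4 = 2)))) ∨
          (2 ∈ insert 2 S ∧ ((EV (insert 2 S) ∧ (t % 4 = 1 ∨ t % 8 = 7)) ∨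
            (¬ EV (insert 2 S) ∧ (t % 4 = 1 ∨ t % 8 = 3))))) =
        P₂.powerset.filter fun S =>
          (EV S ∧ (t % 4 = 1 ∨ t % 8 = 7)) ∨ (¬ EV S ∧ (t % 4 = 1 ∨ t % 8 = 3)) := by
      refine filter_congr fun S _ => ?_
      simp only [mem_insert_self, not_true_eq_false, false_and, false_or, true_and, hEVins S]
    rw [hfirst, hsecond]
    by_cases h41 : t % 4 = 1
    · -- `t ≡ 1 (mod 4)`: both halves keep everything
      have e1 : (P₂.powerset.filter fun S => EV S ∨ (¬ EV S ∧ (t % 4 = 1 ∨ t % 4 = 2))) =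
          P₂.powerset := filter_true_of_mem fun S _ => by
        by_cases hE : EV S
        · exact Or.inl hE
        · exact Or.inr ⟨hE, Or.inl h41⟩
      have e2 : (P₂.powerset.filter fun S =>
          (EV S ∧ (t % 4 = 1 ∨ t % 8 = 7)) ∨ (¬ EV S ∧ (t % 4 = 1 ∨ t % 8 = 3))) = P₂.powerset :=
        filter_true_of_mem fun S _ => by
          by_cases hE : EV S
          · exact Or.inl ⟨hE, Or.inl h41⟩
          · exact Or.inr ⟨hE, Or.inl h41⟩
      rw [e1, e2, card_powerset, if_neg (by rintro (h | ⟨h, -⟩) <;> omega), Nat.sub_zero, hcardP,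
        pow_succ]
      ring
    · by_cases h83 : t % 8 = 3
      · -- `t ≡ 3 (mod 8)`: even subsets on the first half, odd ones on the second
        have e1 : (P₂.powerset.filter fun S => EV S ∨ (¬ EV S ∧ (t % 4 = 1 ∨ t % 4 = 2))) =
            P₂.powerset.filter fun S => EV S := filter_congr fun S _ => by
          have : ¬ (t % 4 = 1 ∨ t % 4 = 2) := by omega
          simp only [this, and_false, or_false]
        have e2 : (P₂.powerset.filter fun S =>
            (EV S ∧ (t % 4 = 1 ∨ t % 8 = 7)) ∨ (¬ EV S ∧ (t % 4 = 1 ∨ t % 8 = 3))) =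
            P₂.powerset.filter fun S => ¬ EV S := filter_congr fun S _ => by
          have h7 : ¬ (t % 4 = 1 ∨ t % 8 = 7) := by omega
          have h3 : (t % 4 = 1 ∨ t % 8 = 3) := Or.inr h83
          simp only [h7, and_false, false_or, h3, and_true]
        rw [e1, e2, card_filter_add_card_filter_not, card_powerset, if_pos (Or.inl h83), hcardP,
          Nat.add_sub_cancel]
      · -- `t ≡ 7 (mod 8)`: even subsets on both halves
        have h87 : t % 8 = 7 := by omega
        have e1 : (P₂.powerset.filter fun S => EV S ∨ (¬ EV S ∧ (t % 4 = 1 ∨ t % 4 = 2))) =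
            P₂.powerset.filter fun S => EV S := filter_congr fun S _ => by
          have : ¬ (t % 4 = 1 ∨ t % 4 = 2) := by omega
          simp only [this, and_false, or_false]
        have e2 : (P₂.powerset.filter fun S =>
            (EV S ∧ (t % 4 = 1 ∨ t % 8 = 7)) ∨ (¬ EV S ∧ (t % 4 = 1 ∨ t % 8 = 3))) =
            P₂.powerset.filter fun S => EV S := filter_congr fun S _ => by
          have h7 : (t % 4 = 1 ∨ t % 8 = 7) := Or.inr h87
          have h3 : ¬ (t % 4 = 1 ∨ t % 8 = 3) := by omega
          simp only [h7, and_true, h3, and_false, or_false]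
        rw [e1, e2, heven_count P₂, hcardP]
        by_cases hβ : ∃ p ∈ P, p % 8 = 5
        · have hβ' : ∃ p ∈ P₂, p % 8 = 5 := hβ2.mp hβ
          have hpos : 1 ≤ P₂.card := by
            obtain ⟨p, hp, _⟩ := hβ'
            exact card_pos.mpr ⟨p, hp⟩
          rw [if_pos hβ', if_pos (Or.inr ⟨Or.inr h87, hβ⟩), Nat.add_sub_cancel]
          have h2 : 2 ^ P₂.card = 2 ^ (P₂.card - 1) * 2 := by
            rw [← pow_succ]
            congr 1
            omega
          rw [h2]
          ring
        · have hβ' : ¬ ∃ p ∈ P₂, p % 8 = 5 := fun h => hβ (hβ2.mpr h)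
          rw [if_neg hβ', if_neg (by rintro (h | ⟨-, h⟩) <;> [omega; exact hβ h]), Nat.sub_zero,
            Nat.sub_zero, pow_succ]
          ring

end Summit.Parity.BatemanHorn.Theorems.PencilSelmerDictionary
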